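import Literature.Computability.AlgebraicComplexity.TripleOrbitClosedOfNoFixedTorus
import Literature.Computability.AlgebraicComplexity.BI17TensorFiniteStabilizerLocusProofs
import Literature.Computability.AlgebraicComplexity.TensorOrbitZariskiClosure
import HarnessLib

/-!
# Mumford's stability criterion for 3-tensors: an `SL³`-invariant separating the bad locus

The tensor twin of `MumfordStabilityOfSmoothForms.lean` (forms: a nonzero `SL`-invariant vanishing
on the singular forms makes every form off its zero set polystable, Mumford GIT Ch. 4 §2 Prop. 4.2),
in the setting of Bürgisser–Ikenmeyer 2017 §4 (`IsPolystableTensor`: the `SL_m^3`-orbit of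
`w ∈ ⊗³ℂ^m` is closed; Prop. 4.10: "almost all `w ∈ ⊗³ℂ^m` are polystable", proved there by
quoting Popov 1970 through the finiteness of the generic stabilizer).

* `isPolystableTensor_of_sl3Invariant_ne_zero`: let `q` be an `SL³`-invariant polynomial function on
  `⊗³ℂ^ι` (`IsSL3Invariant`) which vanishes on every tensor whose traceless infinitesimal stabilizer
  `{(X,Y,Z) ∈ 𝔰𝔩³ | (X⊗1⊗1 + 1⊗Y⊗1 + 1⊗1⊗Z)·v = 0}` is non-zero (`¬ HasTrivialSL3LieStabilizer v`,
  `BI17TensorFiniteStabilizerLocusProofs.lean`). Then every `w` with `q(w) ≠ 0` is polystable.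
  Proof (Mumford): `q` is constant `= q(w) ≠ 0` on the orbit `SL³·w`, hence on its classical
  closure; so every closure point `t'` has trivial traceless Lie stabilizer. If `t'` were fixed by
  a non-trivial real diagonal one-parameter subgroup `(diag(e^{s e₀}), diag(e^{s e₁}), diag(e^{s e₂}))`
  (`∑ e_k = 0`), then `(diag e₀, diag e₁, diag e₂)` would be a non-zero traceless triple in the Lie
  stabilizer of `t'` — contradiction; so no closure point is fixed by a real torus and the orbit is
  closed by the compactness (`KAK`) half `isPolystableTensor_of_closure_noFixedTorus`
  (`TripleOrbitClosedOfNoFixedTorus.lean`).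
* `isZariskiGenericTensor_isPolystableTensor_of_sl3Invariant`: consequently, if such a `q ≠ 0`
  exists, polystability is Zariski-generic on `⊗³ℂ^ι` (`IsZariskiGenericTensor`), with generic set
  `{q ≠ 0}` — the form in which BI 2017 Prop. 4.10 is assembled (the invariant is supplied, for
  `m ≥ 3`, by the separation files of the programme; `m ≤ 2` are in `BI17Prop410OfPopov.lean`,
  `BI17GenericPeriodTwoProofs.lean`).

Theorem-only file (no definitions, no named facts). Honest framing: classical invariant theory
(Mumford 1965 / Kempf–Ness 1979); nothing here bears on VP versus VNP.

## References

* D. Mumford, J. Fogarty, F. Kirwan, *Geometric Invariant Theory*, 3rd ed. (1994), Ch. 1 §2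
  (invariants are constant on orbit closures), Ch. 2 §1, Ch. 4 §2 Prop. 4.2. [MumfordFogartyKirwan1994]
* P. Bürgisser, C. Ikenmeyer, *Fundamental invariants of orbit closures*, J. Algebra 477 (2017),
  §4.1 eq. (4.1), §4.2, Prop. 4.10. [BurgisserIkenmeyer2017]
* G. Kempf, L. Ness, *The length of vectors in representation spaces*, LNM 732 (1979), §1.
-/

noncomputable section

open MvPolynomial
open scoped Matrix Topology

namespace Literature.Computability.AlgebraicComplexity

section TensorMumford

variable {ι : Type*} [Fintype ι] [DecidableEq ι]

/-- The coordinate `(a,b,c)` of the infinitesimal action of a DIAGONAL triple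
`(diag d₁, diag d₂, diag d₃) ∈ 𝔤𝔩³`: `(d₁ a + d₂ b + d₃ c) · t_{abc}` (BI 2017 §4.1 eq. (4.1) at the
identity). [cite: BurgisserIkenmeyer2017, §4.1 eq. (4.1)] -/
theorem lieActTensor_diagonal_apply (d₁ d₂ d₃ : ι → ℂ) (t : ι → ι → ι → ℂ) (a b c : ι) :
    (actTensor (Matrix.diagonal d₁) (1 : Matrix ι ι ℂ) (1 : Matrix ι ι ℂ) t +
        actTensor (1 : Matrix ι ι ℂ) (Matrix.diagonal d₂) (1 : Matrix ι ι ℂ) t +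
        actTensor (1 : Matrix ι ι ℂ) (1 : Matrix ι ι ℂ) (Matrix.diagonal d₃) t) a b c =
      (d₁ a + d₂ b + d₃ c) * t a b c := by
  rw [← (Matrix.diagonal_one : (Matrix.diagonal fun _ : ι => (1 : ℂ)) = 1)]
  simp only [Pi.add_apply, actTensor_diagonal_apply]
  ring

/-- A tensor fixed by the real diagonal one-parameter subgroup
`s ↦ (diag(e^{s e₀}), diag(e^{s e₁}), diag(e^{s e₂}))` is annihilated by its generator
`(diag e₀, diag e₁, diag e₂)`: coordinatewise, `e^{e₀ a + e₁ b + e₂ c} t'_{abc} = t'_{abc}` forces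
`(e₀ a + e₁ b + e₂ c) t'_{abc} = 0` (Kempf–Ness §1; BI 2017 §4.1 eq. (4.1)).
[cite: BurgisserIkenmeyer2017, §4.1 eq. (4.1)] -/
theorem lieActTensor_diagonal_eq_zero_of_fixed (e : Fin 3 → ι → ℝ) (t' : ι → ι → ι → ℂ)
    (hfix : actTensor (Matrix.diagonal fun c => (Real.exp (e 0 c) : ℂ))
        (Matrix.diagonal fun c => (Real.exp (e 1 c) : ℂ))
        (Matrix.diagonal fun c => (Real.exp (e 2 c) : ℂ)) t' = t') :
    actTensor (Matrix.diagonal fun c => (e 0 c : ℂ)) (1 : Matrix ι ι ℂ) (1 : Matrix ι ι ℂ) t' +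
        actTensor (1 : Matrix ι ι ℂ) (Matrix.diagonal fun c => (e 1 c : ℂ)) (1 : Matrix ι ι ℂ) t' +
        actTensor (1 : Matrix ι ι ℂ) (1 : Matrix ι ι ℂ) (Matrix.diagonal fun c => (e 2 c : ℂ)) t' =
      0 := by
  funext a b c
  rw [lieActTensor_diagonal_apply]
  have h := congrFun (congrFun (congrFun hfix a) b) c
  rw [actTensor_diagonal_apply, ← Complex.ofReal_mul, ← Complex.ofReal_mul, ← Real.exp_add,
    ← Real.exp_add] at h
  -- `exp(W) t = t` with `W` real: either `t = 0` or `exp W = 1`, i.e. `W = 0`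
  have hW : ((e 0 a + e 1 b + e 2 c : ℝ) : ℂ) * t' a b c = 0 := by
    rcases eq_or_ne (t' a b c) 0 with ht | ht
    · rw [ht, mul_zero]
    · have hexp : (Real.exp (e 0 a + e 1 b + e 2 c) : ℂ) = 1 :=
        mul_right_cancel₀ ht (by rw [h, one_mul])
      rw [Complex.ofReal_eq_one, Real.exp_eq_one_iff] at hexp
      rw [hexp, Complex.ofReal_zero, zero_mul]
  simpa only [Complex.ofReal_add, Pi.zero_apply] using hW

/-- **Mumford's criterion for 3-tensors, invariant form.** Let `q` be an `SL³`-invariant polynomial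
function on `⊗³ℂ^ι` vanishing on every tensor with non-zero traceless infinitesimal stabilizer.
Then every tensor `w` with `q(w) ≠ 0` is polystable (its `SL_ι^3`-orbit is closed): `q` is constant
on the orbit closure, so no closure point is fixed by a non-trivial real diagonal one-parameter
subgroup of `SL³`, and the compactness half of the Hilbert–Mumford/Kempf–Ness argument
(`isPolystableTensor_of_closure_noFixedTorus`) closes the orbit (GIT Ch. 4 §2 Prop. 4.2, the step
"the stabilizer of a point with non-vanishing invariant is finite, hence the point is stable"; the
mechanism behind BI 2017 Prop. 4.10).
[cite: MumfordFogartyKirwan1994, Ch. 4 §2 Prop. 4.2] [cite: BurgisserIkenmeyer2017, Prop. 4.10] -/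
theorem isPolystableTensor_of_sl3Invariant_ne_zero (w : ι → ι → ι → ℂ)
    {q : MvPolynomial (ι × ι × ι) ℂ} (hq : IsSL3Invariant q) (hqw : aeval (tensorPt w) q ≠ 0)
    (hqbad : ∀ v : ι → ι → ι → ℂ, ¬ HasTrivialSL3LieStabilizer v → aeval (tensorPt v) q = 0) :
    IsPolystableTensor w := by
  refine isPolystableTensor_of_closure_noFixedTorus w fun t' ht' e hesum hfix => ?_
  -- (1) `q` is continuous and constant `= q(w)` on the orbit, hence on its closure
  have hcont : Continuous fun v : ι → ι → ι → ℂ => aeval (tensorPt v) q := by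
    have : (fun v : ι → ι → ι → ℂ => aeval (tensorPt v) q) =
        (fun x : ι × ι × ι → ℂ => MvPolynomial.eval x q) ∘ tensorPt := by
      funext v
      simp
    rw [this]
    exact (MvPolynomial.continuous_eval q).comp continuous_tensorPt
  have hconst : t' ∈ {v : ι → ι → ι → ℂ | aeval (tensorPt v) q = aeval (tensorPt w) q} := by
    refine closure_minimal ?_ (isClosed_eq hcont continuous_const) ht'
    rintro _ ⟨g, rfl⟩
    exact hq g.1 g.2.1 g.2.2 w
  have hqt' : aeval (tensorPt t') q ≠ 0 := by
    rw [Set.mem_setOf_eq] at hconst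
    rwa [hconst]
  -- (2) so the traceless infinitesimal stabilizer of `t'` is trivial
  have htriv : HasTrivialSL3LieStabilizer t' := by
    by_contra h
    exact hqt' (hqbad t' h)
  -- (3) the generator `(diag e₀, diag e₁, diag e₂)` of the fixing torus is a traceless triple
  -- annihilating `t'`, hence zero
  have htr : ∀ k : Fin 3, (Matrix.diagonal fun c => (e k c : ℂ)).trace = 0 := by
    intro k
    rw [Matrix.trace_diagonal, ← Complex.ofReal_sum, hesum k, Complex.ofReal_zero]
  have hfix1 := hfix 1
  simp only [one_mul] at hfix1
  obtain ⟨h0, h1, h2⟩ := htriv _ _ _ (htr 0) (htr 1) (htr 2)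
    (lieActTensor_diagonal_eq_zero_of_fixed e t' hfix1)
  have hd : ∀ k : Fin 3, (fun c => (e k c : ℂ)) = 0 := by
    intro k
    rw [← Matrix.diagonal_eq_zero]
    fin_cases k
    exacts [h0, h1, h2]
  funext k c
  exact Complex.ofReal_eq_zero.mp (congrFun (hd k) c)

/-- **BI 2017 Prop. 4.10, invariant form** ("almost all `w ∈ ⊗³ℂ^m` are polystable"): if there is
a nonzero `SL³`-invariant polynomial function `q` on `⊗³ℂ^ι` vanishing on every tensor with
non-zero traceless infinitesimal stabilizer, then polystability is Zariski-generic, with generic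
set `{q ≠ 0}`. [cite: BurgisserIkenmeyer2017, Prop. 4.10]
[cite: MumfordFogartyKirwan1994, Ch. 4 §2 Prop. 4.2] -/
theorem isZariskiGenericTensor_isPolystableTensor_of_sl3Invariant
    {q : MvPolynomial (ι × ι × ι) ℂ} (hq : IsSL3Invariant q) (hq0 : q ≠ 0)
    (hqbad : ∀ v : ι → ι → ι → ℂ, ¬ HasTrivialSL3LieStabilizer v → aeval (tensorPt v) q = 0) :
    IsZariskiGenericTensor (IsPolystableTensor : (ι → ι → ι → ℂ) → Prop) :=
  ⟨q, hq0, fun w hw => isPolystableTensor_of_sl3Invariant_ne_zero w hq hw hqbad⟩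

end TensorMumford

end Literature.Computability.AlgebraicComplexity
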